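import Literature.Geometry.Riemannian.TwoPiSetup
import HarnessLib

/-!
# The Gromov–Thurston `2π` theorem in dimension `4`: assembly of the metric

Support file (everything proved; no named fact, no `sorry`) completing the proof of the
Gromov–Thurston `2π` theorem `Literature.Geometry.Riemannian.gromovThurston_twoPi_four`
(`CuspedHyperbolic.lean`; Anderson 2006, §2.1, (2.4): "when the length `L(σ)` of `σ` in the
flat torus satisfies `L(σ) ≥ 2π`, the resulting manifold `M_σ` has a complete metric of
non-positive sectional curvature … Briefly, one forms the Euclidean cone of length `1` on `σ`,
and takes the constant skew product with the flat metric on `T^{n-2}` … A natural smoothing of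
this cone singularity gives a metric of non-positive curvature"; Bleiler–Hodgson 1996, Thm. 9 and
its proof by warped products `dr² + f(r)² dμ² + g(r)² dλ²` in dimension `3`).

From the set-up `D : TwoPiSetup g S A P` (`TwoPiSetup.lean`: the glued field of bilinear forms
`D.gval` on the Dehn filling `P`, its pull-back identities along the three families of local
diffeomorphisms — the embedding of the thin part, the enlarged cusp charts, the core charts — and
the covering of `P` by their images) we prove:

* `TwoPiSetup.metric` — `D.gval` is a `C^∞` Riemannian metric on `P` (smoothness descends along
  local diffeomorphisms, `contMDiffAt_of_pullbackBilin_eq`; symmetry and positivity transport);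
* `TwoPiSetup.curvatureForm_nonpos` — its Levi-Civita connection has `Rm(Y, Z, Z, Y) ≤ 0`
  everywhere: by naturality of `Rm` (`curvatureForm_eq_of_val_eq`) this is, on the thin part,
  the sign of the hyperbolic metric (constant curvature `-1` and Cauchy–Schwarz), on the enlarged
  cusps the sign of the one-variable diagonal model (`curvatureForm_oneVarMetric_nonpos` with the
  convexity/monotonicity of the profile, `TwoPiProfile.lean`), and near the core tori the sign of
  the flat core form, obtained on the punctured core from the cusp model through the polar
  identification `Ξ^* F = Lθ^* G` and extended over the core torus by continuity
  (`curvatureForm_nonpos_of_dense`);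
* `exists_metric_nonpos_of_dehnFilling` — the conclusion of the `2π` theorem for a cusp system of
  a Riemannian metric of constant sectional curvature `-1` and a Dehn filling with slopes of
  length `≥ 2π` (completeness and finite volume of the hyperbolic metric are not needed for the
  construction).

## References

* M. T. Anderson, *Dehn filling and Einstein metrics in higher dimensions*, J. Differential Geom.
  73 (2006) 219–261, §2.1, (2.4). [Anderson2006]
* S. A. Bleiler, C. D. Hodgson, *Spherical space forms and Dehn filling*, Topology 35 (1996)
  809–833, Thm. 9. [BleilerHodgson1996]
* B. O'Neill, *Semi-Riemannian geometry* (1983), Ch. 3, Prop. 3.59; Ch. 7, Prop. 7.42. [ONeill1983]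
-/

noncomputable section

open Set Function Filter TopologicalSpace Bundle Real
open scoped Manifold ContDiff Topology InnerProductSpace

namespace Literature.Geometry.Riemannian

open Literature.Geometry.Lorentzian Literature.Geometry.Lorentzian.MetricCoord
  Literature.Geometry.Lorentzian.PseudoRiemannianMetric Literature.Geometry.Manifold
  Literature.Topology.FourManifolds TwoPiCore

variable {X : Type*} [TopologicalSpace X] [ChartedSpace E4 X] [IsManifold (𝓡 4) ∞ X]
  {g : PseudoRiemannianMetric (𝓡 4) ∞ E4 (TangentSpace (𝓡 4) : X → Type _)}
  {k : ℕ} {S : TorusCuspSystem g k 3} {A : Fin k → Matrix (Fin 3) (Fin 3) ℤ}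
  {P : Type*} [TopologicalSpace P] [ChartedSpace E4 P] [IsManifold (𝓡 4) ∞ P]

namespace TwoPiSetup

variable (D : TwoPiSetup g S A P)

/-! ### The three families of local diffeomorphisms and their pull-back identities -/

section Charts

variable [T2Space X] [T2Space P]

/-- The hyperbolic metric restricted to the thin part (pull-back along the inclusion). [folklore] -/
def gThin : PseudoRiemannianMetric (𝓡 4) ∞ E4 (TangentSpace (𝓡 4) : D.thin → Type _) :=
  g.comap contMDiff_pullbackBilin_holds Subtype.val contMDiff_subtype_val
    (fun y ↦ by rw [OpenSubmanifold.mfderiv_subtype_val]; exact injective_id) rfl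

omit [IsManifold (𝓡 4) ∞ P] in
/-- The value of the restricted metric. [folklore] -/
@[simp] theorem gThin_val (u : D.thin) (v w : E4) : D.gThin.val u v w = g.val u.1 v w := by
  change pullbackBilin (I := 𝓡 4) (I' := 𝓡 4) Subtype.val g.val u v w = _
  rw [pullbackBilin_apply, OpenSubmanifold.mfderiv_subtype_val]
  rfl

/-- The embedding of the thin part `f₁ = jA ∘ ι : W → P`. [folklore] -/
def f₁ (u : D.thin) : P := D.jA u.1

omit [IsManifold (𝓡 4) ∞ P] in
/-- `f₁` is smooth. [folklore] -/
theorem contMDiff_f₁ : ContMDiff (𝓡 4) (𝓡 4) ∞ D.f₁ := D.contMDiff_jA.comp contMDiff_subtype_val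

omit [IsManifold (𝓡 4) ∞ P] in
/-- The differential of `f₁` is that of `jA`. [folklore] -/
theorem mfderiv_f₁ (u : D.thin) : mfderiv (𝓡 4) (𝓡 4) D.f₁ u = mfderiv (𝓡 4) (𝓡 4) D.jA u.1 := by
  have h := mfderiv_comp u (D.contMDiff_jA.mdifferentiableAt (by simp))
    (OpenSubmanifold.mdifferentiableAt_subtype_val u)
  rw [OpenSubmanifold.mfderiv_subtype_val] at h
  exact h.trans (ContinuousLinearMap.comp_id _)

omit [IsManifold (𝓡 4) ∞ P] in
/-- The differential of `f₁` is injective. [folklore] -/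
theorem injective_mfderiv_f₁ (u : D.thin) : Injective (mfderiv (𝓡 4) (𝓡 4) D.f₁ u) := by
  rw [mfderiv_f₁]; exact D.injective_mfderiv_jA u.1

omit [IsManifold (𝓡 4) ∞ P] in
/-- **`f₁^* gval = g`** on the thin part. [folklore] -/
theorem pullback_f₁ (u : D.thin) (v w : E4) :
    D.gval (D.f₁ u) (mfderiv (𝓡 4) (𝓡 4) D.f₁ u v) (mfderiv (𝓡 4) (𝓡 4) D.f₁ u w) =
      D.gThin.val u v w := by
  rw [mfderiv_f₁, gThin_val]
  refine (D.gval_pullback_jA u.1 v w).trans ?_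
  rw [D.hatVal_eq_of_mem_thin u.2]
  rfl

/-- The enlarged cusp chart into `P`: `f₂ = jA ∘ Φ ∘ ι : V_cusp → P`. [folklore] -/
def f₂ (i : Fin k) (u : D.Vcusp) : P := D.jA (D.Φ i u.1)

omit [IsManifold (𝓡 4) ∞ P] [T2Space X] [T2Space P] in
/-- `f₂` is smooth. [folklore] -/
theorem contMDiff_f₂ (i : Fin k) : ContMDiff 𝓘(ℝ, E4) (𝓡 4) ∞ (D.f₂ i) :=
  D.contMDiff_jA.comp (((S.cusp i).contMDiffOn_cuspChart (D.fr i)).comp_contMDiff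
    contMDiff_subtype_val fun u ↦ D.region_of_th_lt i u.2)

omit [IsManifold (𝓡 4) ∞ P] [T2Space X] [T2Space P] in
/-- The differential of `f₂`. [folklore] -/
theorem mfderiv_f₂ (i : Fin k) (u : D.Vcusp) :
    mfderiv 𝓘(ℝ, E4) (𝓡 4) (D.f₂ i) u =
      (mfderiv (𝓡 4) (𝓡 4) D.jA (D.Φ i u.1)).comp (mfderiv 𝓘(ℝ, E4) (𝓡 4) (D.Φ i) u.1) := by
  have hΦ : MDifferentiableAt 𝓘(ℝ, E4) (𝓡 4) (D.Φ i) u.1 :=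
    ((S.cusp i).contMDiffAt_cuspChart (D.fr i) (D.region_of_th_lt i u.2)).mdifferentiableAt
      (by simp)
  have hjA : MDifferentiableAt (𝓡 4) (𝓡 4) D.jA (D.Φ i u.1) :=
    D.contMDiff_jA.mdifferentiableAt (by simp)
  have h := mfderiv_comp u (hjA.comp u.1 hΦ) (OpenSubmanifold.mdifferentiableAt_subtype_val u)
  rw [OpenSubmanifold.mfderiv_subtype_val] at h
  have h' := h.trans (ContinuousLinearMap.comp_id _)
  rw [mfderiv_comp u.1 hjA hΦ] at h'
  exact h'

omit [IsManifold (𝓡 4) ∞ P] [T2Space X] [T2Space P] in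
/-- The differential of `f₂` is injective. [folklore] -/
theorem injective_mfderiv_f₂ (i : Fin k) (u : D.Vcusp) :
    Injective (mfderiv 𝓘(ℝ, E4) (𝓡 4) (D.f₂ i) u) := by
  rw [mfderiv_f₂]
  exact (D.injective_mfderiv_jA _).comp (D.injective_mfderiv_Φ i u.2)

omit [IsManifold (𝓡 4) ∞ P] [T2Space X] [T2Space P] in
/-- **`f₂^* gval = G`** on the enlarged cusp. [folklore] -/
theorem pullback_f₂ (i : Fin k) (u : D.Vcusp) (v w : E4) :
    D.gval (D.f₂ i u) (mfderiv 𝓘(ℝ, E4) (𝓡 4) (D.f₂ i) u v) (mfderiv 𝓘(ℝ, E4) (𝓡 4) (D.f₂ i) u w) =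
      (D.G i).val u v w := by
  rw [mfderiv_f₂, G_val]
  exact (D.gval_pullback_jA (D.Φ i u.1) _ _).trans (D.hatVal_pullback_Φ i u.2 v w)

omit [IsManifold (𝓡 4) ∞ P] [T2Space X] [T2Space P] in
/-- **`Ψ^* gval = F`** on the core domain (restated for the core model). [folklore] -/
theorem pullback_Ψ (i : Fin k) (q : D.Vcore i) (v w : E4) :
    D.gval (D.Ψ i q) (mfderiv 𝓘(ℝ, E4) (𝓡 4) (D.Ψ i) q v) (mfderiv 𝓘(ℝ, E4) (𝓡 4) (D.Ψ i) q w) =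
      (D.F i).val q v w := by
  rw [F_val]; exact D.gval_pullback_Ψ i q v w

end Charts

/-! ### The metric -/

section Metric

variable [T2Space X] [T2Space P]

/-- **The glued field is smooth** (as a section of `Hom(TP, Hom(TP, ℝ))`): at every point it is
locally a push-forward of a smooth metric along a local diffeomorphism
(`contMDiffAt_of_pullbackBilin_eq` and the covering). [folklore] -/
theorem contMDiffAt_gval (p : P) :
    ContMDiffAt (𝓡 4) ((𝓡 4).prod 𝓘(ℝ, E4 →L[ℝ] E4 →L[ℝ] ℝ)) ∞
      (fun p : P ↦ TotalSpace.mk' (E4 →L[ℝ] E4 →L[ℝ] ℝ)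
        (E := fun p : P ↦ TangentSpace (𝓡 4) p →L[ℝ] TangentSpace (𝓡 4) p →L[ℝ] ℝ) p (D.gval p)) p := by
  rcases D.cover p with ⟨x, hx, rfl⟩ | ⟨i, q, hq, rfl⟩ | ⟨i, q, rfl⟩
  · exact contMDiffAt_of_pullbackBilin_eq (I := 𝓡 4) (J := 𝓡 4) D.gThin D.gval (f := D.f₁)
      (u₀ := ⟨x, hx⟩) isOpen_univ (mem_univ _) D.contMDiff_f₁.contMDiffOn
      (D.injective_mfderiv_f₁ _) (Eventually.of_forall fun u ↦ by
        ext v w; rw [pullbackBilin_apply]; exact D.pullback_f₁ u v w)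
  · exact contMDiffAt_of_pullbackBilin_eq (I := 𝓘(ℝ, E4)) (J := 𝓡 4) (D.G i) D.gval (f := D.f₂ i)
      (u₀ := ⟨q, hq⟩) isOpen_univ (mem_univ _) (D.contMDiff_f₂ i).contMDiffOn
      (D.injective_mfderiv_f₂ i _) (Eventually.of_forall fun u ↦ by
        ext v w; rw [pullbackBilin_apply]; exact D.pullback_f₂ i u v w)
  · exact contMDiffAt_of_pullbackBilin_eq (I := 𝓘(ℝ, E4)) (J := 𝓡 4) (D.F i) D.gval (f := D.Ψ i)
      (u₀ := q) isOpen_univ (mem_univ _) (D.contMDiff_Ψ i).contMDiffOn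
      (D.injective_mfderiv_Ψ i q) (Eventually.of_forall fun u ↦ by
        ext v w; rw [pullbackBilin_apply]; exact D.pullback_Ψ i u v w)

omit [IsManifold (𝓡 4) ∞ P] in
/-- **The glued field is symmetric.** [folklore] -/
theorem gval_symm (p : P) (v w : E4) : D.gval p v w = D.gval p w v := by
  rcases D.cover p with ⟨x, hx, rfl⟩ | ⟨i, q, hq, rfl⟩ | ⟨i, q, rfl⟩
  · exact symm_of_pullback_eq (I := 𝓡 4) (J := 𝓡 4) (f := D.f₁) (u := ⟨x, hx⟩)
      (D.injective_mfderiv_f₁ _) (b := D.gThin.val ⟨x, hx⟩) (fun v w ↦ D.gThin.symm _ v w)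
      (D.pullback_f₁ _) v w
  · exact symm_of_pullback_eq (I := 𝓘(ℝ, E4)) (J := 𝓡 4) (f := D.f₂ i) (u := ⟨q, hq⟩)
      (D.injective_mfderiv_f₂ i _) (b := (D.G i).val ⟨q, hq⟩) (fun v w ↦ (D.G i).symm _ v w)
      (D.pullback_f₂ i _) v w
  · exact symm_of_pullback_eq (I := 𝓘(ℝ, E4)) (J := 𝓡 4) (f := D.Ψ i) (u := q)
      (D.injective_mfderiv_Ψ i q) (b := (D.F i).val q) (fun v w ↦ (D.F i).symm _ v w)
      (D.pullback_Ψ i q) v w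

omit [IsManifold (𝓡 4) ∞ P] in
/-- **The glued field is positive definite.** [folklore] -/
theorem gval_pos (hgR : g.IsRiemannian) (p : P) (v : E4) (hv : v ≠ 0) : 0 < D.gval p v v := by
  rcases D.cover p with ⟨x, hx, rfl⟩ | ⟨i, q, hq, rfl⟩ | ⟨i, q, rfl⟩
  · refine pos_of_pullback_eq (I := 𝓡 4) (J := 𝓡 4) (f := D.f₁) (u := ⟨x, hx⟩)
      (D.injective_mfderiv_f₁ _) (b := D.gThin.val ⟨x, hx⟩) (fun v hv ↦ ?_) (D.pullback_f₁ _) v hv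
    rw [gThin_val]
    exact hgR x v hv
  · exact pos_of_pullback_eq (I := 𝓘(ℝ, E4)) (J := 𝓡 4) (f := D.f₂ i) (u := ⟨q, hq⟩)
      (D.injective_mfderiv_f₂ i _) (b := (D.G i).val ⟨q, hq⟩)
      (fun v hv ↦ isRiemannian_oneVarMetric _ _ _ _ _ v hv) (D.pullback_f₂ i _) v hv
  · exact pos_of_pullback_eq (I := 𝓘(ℝ, E4)) (J := 𝓡 4) (f := D.Ψ i) (u := q)
      (D.injective_mfderiv_Ψ i q) (b := (D.F i).val q)
      (fun v hv ↦ isRiemannian_riemannianOfRepr _ v hv) (D.pullback_Ψ i q) v hv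

/-- **The smoothed metric of the Dehn filling** (Anderson 2006, §2.1, (2.4); Bleiler–Hodgson
1996, Thm. 9): the glued field `D.gval` as a `C^∞` Riemannian metric on `P`.
[cite: Anderson2006, §2.1, (2.4)] -/
def metric (hgR : g.IsRiemannian) : PseudoRiemannianMetric (𝓡 4) ∞ E4 (TangentSpace (𝓡 4) : P → Type _) where
  val := D.gval
  symm := D.gval_symm
  nondegenerate p v hv := by
    by_contra h
    exact (D.gval_pos hgR p v h).ne' (hv v)
  contMDiff := D.contMDiffAt_gval

/-- The value of the smoothed metric. [folklore] -/
@[simp] theorem metric_val (hgR : g.IsRiemannian) (p : P) : (D.metric hgR).val p = D.gval p := rfl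

/-- The smoothed metric is Riemannian. [folklore] -/
theorem isRiemannian_metric (hgR : g.IsRiemannian) : (D.metric hgR).IsRiemannian :=
  fun p v hv ↦ D.gval_pos hgR p v hv

end Metric

/-! ### Curvature of the models -/

section Models

/-- **Cauchy–Schwarz for a positive semi-definite symmetric form**: `B(v,w)² ≤ B(v,v) B(w,w)`.
[folklore] -/
theorem sq_le_mul_of_nonneg (B : E4 →L[ℝ] E4 →L[ℝ] ℝ) (hsymm : ∀ v w, B v w = B w v)
    (hnn : ∀ v, 0 ≤ B v v) (v w : E4) : B v w ^ 2 ≤ B v v * B w w := by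
  have hq : ∀ t : ℝ, 0 ≤ B w w * (t * t) + 2 * B v w * t + B v v := by
    intro t
    have h := hnn (v + t • w)
    have : B (v + t • w) (v + t • w) = B w w * (t * t) + 2 * B v w * t + B v v := by
      simp only [map_add, map_smul, _root_.add_apply, _root_.smul_apply, smul_eq_mul, hsymm w v]
      ring
    linarith [this ▸ h]
  have hd := discrim_le_zero hq
  rw [discrim] at hd
  nlinarith [hd]

variable [T2Space X] [T2Space P]

omit [T2Space X] in
/-- **The hyperbolic metric has nonpositive sectional curvature**: constant curvature `-1` gives
`Rm(Y, Z, Z, Y) = -(g(Y,Y) g(Z,Z) - g(Y,Z)²) ≤ 0` by Cauchy–Schwarz. [cite: ONeill1983, Ch. 3, Prop. 3.59] -/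
theorem curvatureForm_nonpos_of_hyperbolic (hgR : g.IsRiemannian)
    (hK : g.HasConstantSectionalCurvature (-1)) [g.HasLeviCivita] (x : X) (Y Z : E4) :
    g.curvatureForm g.leviCivita x Y Z Z Y ≤ 0 := by
  rw [(hK g.leviCivita g.isLeviCivita_leviCivita_holds).curvatureForm_pair]
  have hcs := sq_le_mul_of_nonneg (g.val x) (g.symm x) (fun v ↦ by
    by_cases hv : v = 0
    · simp [hv]
    · exact (hgR x v hv).le) Y Z
  have halg : -1 * (g.val x Y Y * g.val x Z Z - g.val x Y Z ^ 2) =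
      g.val x Y Z ^ 2 - g.val x Y Y * g.val x Z Z := by ring
  rw [halg]
  exact sub_nonpos.2 hcs

omit [IsManifold (𝓡 4) ∞ P] in
/-- The restricted metric of the thin part has nonpositive sectional curvature (naturality
along the inclusion). [folklore] -/
theorem curvatureForm_gThin_nonpos (hgR : g.IsRiemannian) (hK : g.HasConstantSectionalCurvature (-1))
    [g.HasLeviCivita] [D.gThin.HasLeviCivita] (u : D.thin) (Y Z : E4) :
    D.gThin.curvatureForm D.gThin.leviCivita u Y Z Z Y ≤ 0 := by
  have h := curvatureForm_eq_of_val_eq (g := g) (Φ := (Subtype.val : D.thin → X))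
    contMDiff_subtype_val (fun y ↦ by rw [OpenSubmanifold.mfderiv_subtype_val]; exact injective_id)
    rfl D.gThin (fun u v w ↦ by rw [OpenSubmanifold.mfderiv_subtype_val]; exact D.gThin_val u v w)
    u Y Z Z Y
  rw [h, OpenSubmanifold.mfderiv_subtype_val]
  exact curvatureForm_nonpos_of_hyperbolic hgR hK u.1 Y Z

omit [IsManifold (𝓡 4) ∞ P] [T2Space X] [T2Space P] in
/-- **The cusp model has nonpositive sectional curvature** (`curvatureForm_oneVarMetric_nonpos`
with the convexity and monotonicity of the profile). [cite: ONeill1983, Ch. 7, Prop. 7.42] -/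
theorem curvatureForm_G_nonpos (i : Fin k) [(D.G i).HasLeviCivita] (u : D.Vcusp) (Y Z : E4) :
    (D.G i).curvatureForm (D.G i).leviCivita u Y Z Z Y ≤ 0 := by
  haveI : (oneVarMetric D.Vcusp (D.c i) (D.c_smooth i) (D.c_pos i)).HasLeviCivita := ‹(D.G i).HasLeviCivita›
  exact curvatureForm_oneVarMetric_nonpos D.Vcusp (D.c i) (D.c_smooth i) (D.c_pos i) u
    (fun a ha ↦ D.c_conv i (u.1 3) a ha) (fun a b ha hb hab ↦ D.c_mono i (u.1 3) a b ha hb hab) Y Z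

omit [IsManifold (𝓡 4) ∞ P] [T2Space X] [T2Space P] in
/-- `Lθ` is injective (the slope basis is a basis). [folklore] -/
theorem injective_thetaToY (i : Fin k) : Injective ((D.fr i).thetaToY) := by
  intro V W h
  rw [← sub_eq_zero]
  set U := V - W with hU
  have hLU : (D.fr i).thetaToY U = 0 := by rw [hU, map_sub, h, sub_self]
  have h3 : U 3 = 0 := by
    have := congrArg (fun z : E4 ↦ z 3) hLU
    simpa using this
  have hx : xTheta (slopeBasis S A i) U = 0 := by
    rw [← (D.fr i).sum_thetaToY_smul U, hLU]
    simp
  have hsum : ∑ j, (![U 0, U 1, U 2] : Fin 3 → ℝ) j • slopeBasis S A i j = 0 := by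
    rw [xTheta] at hx
    have hπ : (2 * π)⁻¹ ≠ 0 := by positivity
    have := (smul_eq_zero.1 hx).resolve_left hπ
    rw [Fin.sum_univ_three]
    simpa using this
  have hli := Fintype.linearIndependent_iff.1 (D.linearIndependent i) _ hsum
  ext j
  fin_cases j
  · simpa using hli 0
  · simpa using hli 1
  · simpa using hli 2
  · simpa using h3

/-- `Lθ` restricted to the polar domain lands in the enlarged cusp domain. [folklore] -/
def LθO (i : Fin k) (r : D.O i) : D.Vcusp :=
  ⟨(D.fr i).thetaToY r.1, by
    rw [mem_Vcusp, SlopeFrame.thetaToY_apply_three]; exact D.th_lt_of_mem_O r.2⟩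

omit [IsManifold (𝓡 4) ∞ P] [T2Space X] [T2Space P] in
/-- `LθO` is smooth. [folklore] -/
theorem contMDiff_LθO (i : Fin k) : ContMDiff 𝓘(ℝ, E4) 𝓘(ℝ, E4) (∞ + 1) (D.LθO i) :=
  (ContMDiff.subtypeVal_comp_iff D.Vcusp (D.LθO i)).1
    (((D.fr i).thetaToY).contMDiff.comp contMDiff_subtype_val)

omit [IsManifold (𝓡 4) ∞ P] [T2Space X] [T2Space P] in
/-- The differential of `LθO` is `Lθ`. [folklore] -/
theorem mfderiv_LθO (i : Fin k) (r : D.O i) :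
    mfderiv 𝓘(ℝ, E4) 𝓘(ℝ, E4) (D.LθO i) r = ((D.fr i).thetaToY : E4 →L[ℝ] E4) := by
  rw [mfderiv_eq_of_coe_comp ((D.fr i).thetaToY : E4 → E4) (D.LθO i) (fun _ ↦ rfl) r
    ((D.contMDiff_LθO i).mdifferentiableAt (by simp)) ((D.fr i).thetaToY).mdifferentiableAt,
    ContinuousLinearMap.mfderiv_eq]

/-- The cusp model pulled back to the polar domain along `Lθ`. [folklore] -/
def gO (i : Fin k) : PseudoRiemannianMetric 𝓘(ℝ, E4) ∞ E4 (TangentSpace 𝓘(ℝ, E4) : D.O i → Type _) :=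
  (D.G i).comap contMDiff_pullbackBilin_holds (D.LθO i) (D.contMDiff_LθO i)
    (fun r ↦ by rw [mfderiv_LθO]; exact D.injective_thetaToY i) rfl

omit [IsManifold (𝓡 4) ∞ P] [T2Space X] [T2Space P] in
/-- The value of `gO`. [folklore] -/
theorem gO_val (i : Fin k) (r : D.O i) (v w : E4) :
    (D.gO i).val r v w = diagMetric (oneVar (D.c i)) ((D.fr i).thetaToY r.1) ((D.fr i).thetaToY v)
      ((D.fr i).thetaToY w) := by
  change pullbackBilin (I := 𝓘(ℝ, E4)) (I' := 𝓘(ℝ, E4)) (D.LθO i) (D.G i).val r v w = _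
  rw [pullbackBilin_apply, mfderiv_LθO]
  rfl

omit [IsManifold (𝓡 4) ∞ P] [T2Space X] [T2Space P] in
/-- `gO` has nonpositive sectional curvature (naturality along `LθO`). [folklore] -/
theorem curvatureForm_gO_nonpos (i : Fin k) [(D.G i).HasLeviCivita] [(D.gO i).HasLeviCivita]
    (r : D.O i) (Y Z : E4) : (D.gO i).curvatureForm (D.gO i).leviCivita r Y Z Z Y ≤ 0 := by
  rw [curvatureForm_eq_of_val_eq (g := D.G i) (Φ := D.LθO i) (D.contMDiff_LθO i)
    (fun r ↦ by rw [mfderiv_LθO]; exact D.injective_thetaToY i) rfl (D.gO i) (fun r v w ↦ rfl)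
    r Y Z Z Y]
  exact D.curvatureForm_G_nonpos i _ _ _

omit [IsManifold (𝓡 4) ∞ P] [T2Space X] [T2Space P] in
/-- **The polar identification at the level of metrics**: `gO = Ξ^* F` pointwise
(`coreForm_polar`). [cite: Anderson2006, §2.1, (2.4)] -/
theorem gO_val_eq_pullback_Ξ (i : Fin k) (r : D.O i) (v w : E4) :
    (D.gO i).val r v w = (D.F i).val (D.Ξ i r) (mfderiv 𝓘(ℝ, E4) 𝓘(ℝ, E4) (D.Ξ i) r v)
      (mfderiv 𝓘(ℝ, E4) 𝓘(ℝ, E4) (D.Ξ i) r w) := by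
  rw [gO_val, mfderiv_Ξ, F_val, coe_Ξ]
  obtain ⟨h0, h1, h2, h3⟩ := D.c_core i (r.1 3) (D.T_lt_of_mem_O r.2).le
  exact ((D.fr i).coreForm_polar (D.slope_ne_zero i) r.1 h0 h1 h2 h3 v w).symm

omit [IsManifold (𝓡 4) ∞ P] [T2Space X] [T2Space P] in
/-- **The core model has nonpositive sectional curvature on the punctured core domain**
(naturality along `Ξ'` from `gO`). [folklore] -/
theorem curvatureForm_F_nonpos_of_Ξ (i : Fin k) [(D.G i).HasLeviCivita] [(D.gO i).HasLeviCivita]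
    [(D.F i).HasLeviCivita] (r : D.O i) (Y Z : E4) :
    (D.F i).curvatureForm (D.F i).leviCivita (D.Ξ i r) Y Z Z Y ≤ 0 := by
  have hΞ' : ∀ r : D.O i, Injective (mfderiv 𝓘(ℝ, E4) 𝓘(ℝ, E4) (D.Ξ i) r) := fun r ↦ by
    rw [mfderiv_Ξ]; exact polarDeriv_injective r.1
  refine nonpos_of_pullback_eq₄ (I := 𝓘(ℝ, E4)) (J := 𝓘(ℝ, E4)) (f := D.Ξ i) (u := r) (hΞ' r)
    (t := fun a b c d ↦ (D.F i).curvatureForm (D.F i).leviCivita (D.Ξ i r) a b c d)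
    (r := fun a b c d ↦ (D.gO i).curvatureForm (D.gO i).leviCivita r a b c d)
    (fun v w ↦ D.curvatureForm_gO_nonpos i r v w) (fun v w x y ↦ ?_) Y Z
  exact (curvatureForm_eq_of_val_eq (g := D.F i) (Φ := D.Ξ i) (D.contMDiff_Ξ i)
    hΞ' rfl (D.gO i) (D.gO_val_eq_pullback_Ξ i) r v w x y).symm

omit [IsManifold (𝓡 4) ∞ P] [T2Space X] [T2Space P] in
/-- The punctured plane is dense: every point of `V_core` is a limit of non-core points.
[folklore] -/
theorem subset_closure_puncture (i : Fin k) :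
    ((D.Vcore i : Opens E4) : Set E4) ⊆ closure {r : E4 | r 2 ≠ 0 ∨ r 3 ≠ 0} := by
  intro r _
  by_cases hr : r ∈ {r : E4 | r 2 ≠ 0 ∨ r 3 ≠ 0}
  · exact subset_closure hr
  · simp only [mem_setOf_eq, not_or, not_not] at hr
    have ht : Tendsto (fun n : ℕ ↦ r + (1 / ((n : ℝ) + 1)) • (eb (2 : Fin 4) : E4)) atTop (𝓝 r) := by
      have := ((tendsto_one_div_add_atTop_nhds_zero_nat (𝕜 := ℝ)).smul_const (eb (2 : Fin 4) : E4)).const_add r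
      simpa using this
    refine mem_closure_of_tendsto ht (Eventually.of_forall fun n ↦ Or.inl ?_)
    have hn : (1 / ((n : ℝ) + 1)) ≠ 0 := by positivity
    simpa [hr.1, eb_apply] using hn

omit [IsManifold (𝓡 4) ∞ P] [T2Space X] [T2Space P] in
/-- **The core model has nonpositive sectional curvature everywhere on the core domain**: on the
punctured domain by `curvatureForm_F_nonpos_of_Ξ`, over the core torus by continuity
(`curvatureForm_nonpos_of_dense`). [cite: Anderson2006, §2.1, (2.4)] -/
theorem curvatureForm_F_nonpos (i : Fin k) [(D.G i).HasLeviCivita] [(D.gO i).HasLeviCivita]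
    [(D.F i).HasLeviCivita] (q : D.Vcore i) (Y Z : E4) :
    (D.F i).curvatureForm (D.F i).leviCivita q Y Z Z Y ≤ 0 := by
  refine curvatureForm_nonpos_of_dense (V := D.Vcore i)
    (G := (D.fr i).coreForm (D.κ i) (D.lam i)) (fun y ↦ rfl) (D.subset_closure_puncture i)
    (fun y hy Y Z ↦ ?_) q Y Z
  obtain ⟨r, rfl⟩ := D.exists_Ξ_eq y hy
  exact D.curvatureForm_F_nonpos_of_Ξ i r Y Z

end Models

/-! ### Curvature of the smoothed metric -/

section Curvature

variable [T2Space X] [T2Space P]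

/-- **The smoothed metric has nonpositive sectional curvature**: `Rm(Y, Z, Z, Y) ≤ 0` at every
point for its Levi-Civita connection — by naturality of `Rm` along the three families of local
diffeomorphisms and the signs of the three models. [cite: Anderson2006, §2.1, (2.4)] -/
theorem curvatureForm_metric_nonpos (hgR : g.IsRiemannian)
    (hK : g.HasConstantSectionalCurvature (-1)) [(D.metric hgR).HasLeviCivita] (p : P) (Y Z : E4) :
    (D.metric hgR).curvatureForm (D.metric hgR).leviCivita p Y Z Z Y ≤ 0 := by
  haveI := g.hasLeviCivita
  haveI := D.gThin.hasLeviCivita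
  haveI := fun i ↦ (D.G i).hasLeviCivita
  haveI := fun i ↦ (D.gO i).hasLeviCivita
  haveI := fun i ↦ (D.F i).hasLeviCivita
  rcases D.cover p with ⟨x, hx, rfl⟩ | ⟨i, q, hq, rfl⟩ | ⟨i, q, rfl⟩
  · refine nonpos_of_pullback_eq₄ (I := 𝓡 4) (J := 𝓡 4) (f := D.f₁) (u := ⟨x, hx⟩)
      (D.injective_mfderiv_f₁ _)
      (t := fun a b c d ↦ (D.metric hgR).curvatureForm (D.metric hgR).leviCivita (D.f₁ ⟨x, hx⟩)
        a b c d)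
      (r := fun a b c d ↦ D.gThin.curvatureForm D.gThin.leviCivita ⟨x, hx⟩ a b c d)
      (fun v w ↦ D.curvatureForm_gThin_nonpos hgR hK _ v w) (fun v w a b ↦ ?_) Y Z
    exact (curvatureForm_eq_of_val_eq (g := D.metric hgR) (Φ := D.f₁) D.contMDiff_f₁
      D.injective_mfderiv_f₁ rfl D.gThin (fun u v w ↦ (D.pullback_f₁ u v w).symm) _ v w a b).symm
  · refine nonpos_of_pullback_eq₄ (I := 𝓘(ℝ, E4)) (J := 𝓡 4) (f := D.f₂ i) (u := ⟨q, hq⟩)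
      (D.injective_mfderiv_f₂ i _)
      (t := fun a b c d ↦ (D.metric hgR).curvatureForm (D.metric hgR).leviCivita (D.f₂ i ⟨q, hq⟩)
        a b c d)
      (r := fun a b c d ↦ (D.G i).curvatureForm (D.G i).leviCivita ⟨q, hq⟩ a b c d)
      (fun v w ↦ D.curvatureForm_G_nonpos i _ v w) (fun v w a b ↦ ?_) Y Z
    exact (curvatureForm_eq_of_val_eq (g := D.metric hgR) (Φ := D.f₂ i)
      (D.contMDiff_f₂ i) (D.injective_mfderiv_f₂ i) rfl (D.G i)
      (fun u v w ↦ (D.pullback_f₂ i u v w).symm) _ v w a b).symm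
  · refine nonpos_of_pullback_eq₄ (I := 𝓘(ℝ, E4)) (J := 𝓡 4) (f := D.Ψ i) (u := q)
      (D.injective_mfderiv_Ψ i q)
      (t := fun a b c d ↦ (D.metric hgR).curvatureForm (D.metric hgR).leviCivita (D.Ψ i q) a b c d)
      (r := fun a b c d ↦ (D.F i).curvatureForm (D.F i).leviCivita q a b c d)
      (fun v w ↦ D.curvatureForm_F_nonpos i q v w) (fun v w a b ↦ ?_) Y Z
    exact (curvatureForm_eq_of_val_eq (g := D.metric hgR) (Φ := D.Ψ i)
      (D.contMDiff_Ψ i) (D.injective_mfderiv_Ψ i) rfl (D.F i)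
      (fun u v w ↦ (D.pullback_Ψ i u v w).symm) _ v w a b).symm

end Curvature

end TwoPiSetup

/-! ### The `2π` theorem -/

/-- **The Gromov–Thurston `2π` theorem in dimension `4`, core statement.** Let `X` be a
Hausdorff `4`-manifold with a `C^∞` Riemannian metric `g` of constant sectional curvature `-1`,
`S` a complete system of rank-`3` torus cusps of `(X, g)`, `A` filling data, and `P` a Hausdorff
`4`-manifold which is the Dehn filling of `X` along `A` (`IsDehnFilling S A P`). If every slope
has flat length `≥ 2π` on its cusp torus, then `P` carries a `C^∞` Riemannian metric with a
Levi-Civita connection of nonpositive sectional curvature, `Rm(Y, Z, Z, Y) ≤ 0` — the metric is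
the hyperbolic metric of the thick part glued to the warped-product smoothing
`c₀(t)(dy₀² + dy₁²) + c₂(t) dy₂² + c₃(t) dt²` of each cusp, which near each core torus is the flat
`T² × D²` (Anderson 2006, §2.1, (2.4); Bleiler–Hodgson 1996, Thm. 9). Completeness and finite
volume of `g` are not needed. [cite: Anderson2006, §2.1, (2.4)] -/
theorem exists_metric_nonpos_of_dehnFilling [T2Space X] [T2Space P] (hgR : g.IsRiemannian)
    (hK : g.HasConstantSectionalCurvature (-1)) (hP : IsDehnFilling S A P)
    (hL : ∀ i, 2 * π ≤ (S.cusp i).slopeLength fun l ↦ A i l 2) :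
    ∃ (g' : PseudoRiemannianMetric (𝓡 4) ∞ E4 (TangentSpace (𝓡 4) : P → Type _))
      (cov : CovariantDerivative (𝓡 4) E4 (TangentSpace (𝓡 4) : P → Type _)),
      g'.IsRiemannian ∧ g'.IsLeviCivita cov ∧
        ∀ (x : P) (Y Z : TangentSpace (𝓡 4) x), g'.curvatureForm cov x Y Z Z Y ≤ 0 := by
  obtain ⟨D⟩ := TwoPiSetup.exists hP hL
  haveI := (D.metric hgR).hasLeviCivita
  exact ⟨D.metric hgR, (D.metric hgR).leviCivita, D.isRiemannian_metric hgR,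
    (D.metric hgR).isLeviCivita_leviCivita_holds, D.curvatureForm_metric_nonpos hgR hK⟩

end Literature.Geometry.Riemannian
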